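import Summits.QuantumAdvantage.AdviceFreeQNC0.OddPrimeStatements
import HarnessLib

/-!
# The ODD-CONFIGURATION IDENTITY of the u-walk game across a separator (cell qa-qnc0, route OddPrimeWalk) — part 1/2

Support items stmt-QuantumAdvantage-23990 `BlindPairLaw`, stmt-QuantumAdvantage-24030 `FarAffinePairLaw`,
stmt-QuantumAdvantage-24031 `FarDegreePairLaw` (planner qa-qnc0-p2 g29, ROUND-29 §4.2, THM 29-A).  AUTHORED AND PROVED BY THE
PLANNER SEAT qa-qnc0-p2 g29 (`HOME/qa-qnc0-p2/line29/ConfigParity.lean`, farm rc 0); landed verbatim (split for the 400-line rule,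
one-line docstrings added) by qn-prover-3 g18, asks P2-29a/b/c.

Across a separator `m` write an input as `glue m s s'` (bits `< m` from `s`, bits `≥ m` from `s'`).
If `p : ιA → inputs`, `q : ιB → inputs` are ODD configurations such that for every cut `g ≤ m` and every
`i` the parity of `#{j in Bob-class b : cut g fires on glue (p i) (q j)}` does not depend on `b`, and
symmetrically for cuts `g > m`, then some glued pair is LOST (`ringWinU = false`): `configParity`.
No `𝔽₄`: the only arithmetic is "among three consecutive residues mod 3 exactly two are nonzero".
Consumers: `BlindPairLaw` (stmt-23990: one point per class, `blind_exists_lose` here), `FarAffinePairLaw` (stmt-24030: zero-sum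
class triples, part 2 `OddPrimeWalkOddConfigAffine`), `FarDegreePairLaw` (stmt-24031: Kummer block designs).
WHAT THIS IS NOT: instrument (bankable theorem of the u-walk game with ARBITRARY fire rules); separation NOT moved.
-/
namespace Summit.QuantumAdvantage.AdviceFreeQNC0.OddConfig

open Finset

variable {n : ℕ}

/-- glue the `A`-part (positions `< m`) of `s` with the `B`-part (positions `≥ m`) of `s'`. -/
def glue (m : ℕ) (s s' : Fin n → Bool) : Fin n → Bool := fun i => if i.val < m then s i else s' i

/-- weight of the `A`-part. -/
def wtA (m : ℕ) (s : Fin n → Bool) : ℕ := (univ.filter fun i : Fin n => i.val < m ∧ s i = true).card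

/-- weight of the `B`-part. -/
def wtB (m : ℕ) (s : Fin n → Bool) : ℕ := (univ.filter fun i : Fin n => ¬ i.val < m ∧ s i = true).card

/-- weight of the `B`-part strictly before position `g`. -/
def wtMid (m g : ℕ) (s : Fin n → Bool) : ℕ :=
  (univ.filter fun i : Fin n => ¬ i.val < m ∧ (i.val < g ∧ s i = true)).card

/-- total weight of a glued input = `A`-weight of the first argument + `B`-weight of the second. -/
theorem wt_glue (m : ℕ) (s s' : Fin n → Bool) : wt (glue m s s') = wtA m s + wtB m s' := by
  unfold wt wtA wtB
  have h := card_filter_add_card_filter_not (s := univ.filter fun i : Fin n => glue m s s' i = true)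
    (fun i : Fin n => i.val < m)
  rw [← h]
  simp only [filter_filter]
  congr 1
  · congr 1
    exact filter_congr (fun i _ => by by_cases hm : i.val < m <;> simp [glue, hm])
  · congr 1
    exact filter_congr (fun i _ => by by_cases hm : i.val < m <;> simp [glue, hm])

/-- prefix weights before the separator only see the `A`-part. -/
theorem wtPrefix_glue_of_le {m g : ℕ} (hg : g ≤ m) (s s' : Fin n → Bool) :
    wtPrefix (glue m s s') g = wtPrefix s g := by
  unfold wtPrefix
  congr 1
  exact filter_congr (fun i _ => by
    by_cases h : i.val < g
    · have hm : i.val < m := lt_of_lt_of_le h hg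
      simp [glue, hm, h]
    · simp [h])

/-- prefix weights after the separator = full `A`-weight + the `B`-part strictly before the cut. -/
theorem wtPrefix_glue_of_ge {m g : ℕ} (hg : m ≤ g) (s s' : Fin n → Bool) :
    wtPrefix (glue m s s') g = wtA m s + wtMid m g s' := by
  unfold wtPrefix wtA wtMid
  have h := card_filter_add_card_filter_not
    (s := univ.filter fun i : Fin n => i.val < g ∧ glue m s s' i = true) (fun i : Fin n => i.val < m)
  rw [← h]
  simp only [filter_filter]
  congr 1
  · congr 1
    exact filter_congr (fun i _ => by
      by_cases hm : i.val < m
      · have hig : i.val < g := lt_of_lt_of_le hm hg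
        simp [glue, hm, hig]
      · simp [hm])
  · congr 1
    exact filter_congr (fun i _ => by by_cases hm : i.val < m <;> simp [glue, hm])

/-- walk exponent of a glued input at a cut `g ≤ m`. -/
theorem walkExp_glue_of_le {m g : ℕ} (hg : g ≤ m) (s s' : Fin n → Bool) :
    walkExp (glue m s s') g = wtA m s + wtB m s' + wtPrefix s g := by
  rw [walkExp, wt_glue, wtPrefix_glue_of_le hg]

/-- walk exponent of a glued input at a cut `g ≥ m`. -/
theorem walkExp_glue_of_ge {m g : ℕ} (hg : m ≤ g) (s s' : Fin n → Bool) :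
    walkExp (glue m s s') g = wtA m s + wtB m s' + (wtA m s + wtMid m g s') := by
  rw [walkExp, wt_glue, wtPrefix_glue_of_ge hg]

/-- among `K, K+1, K+2` exactly two are nonzero mod 3 (as a vanishing sum in `ZMod 2`). -/
theorem sum_three_live (K : ℕ) (x : ZMod 2) :
    (∑ b ∈ range 3, if (K + b) % 3 ≠ 0 then x else 0) = 0 := by
  have hx : x + x = 0 := by
    have h2 : ∀ z : ZMod 2, z + z = 0 := by decide
    exact h2 x
  simp only [sum_range_succ, sum_range_zero, zero_add]
  have h3 : K % 3 = 0 ∨ K % 3 = 1 ∨ K % 3 = 2 := by omega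
  rcases h3 with h | h | h
  · have h1 : (K + 1) % 3 ≠ 0 := by omega
    have h2 : (K + 2) % 3 ≠ 0 := by omega
    simp [h, h1, h2, hx]
  · have h1 : (K + 1) % 3 ≠ 0 := by omega
    have h2 : (K + 2) % 3 = 0 := by omega
    simp [h, h1, h2, hx]
  · have h1 : (K + 1) % 3 = 0 := by omega
    have h2 : (K + 2) % 3 ≠ 0 := by omega
    simp [h, h1, h2, hx]

/-- among `K, K+2, K+4` exactly two are nonzero mod 3. -/
theorem sum_three_live2 (K : ℕ) (x : ZMod 2) :
    (∑ a ∈ range 3, if (K + 2 * a) % 3 ≠ 0 then x else 0) = 0 := by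
  have hx : x + x = 0 := by
    have h2 : ∀ z : ZMod 2, z + z = 0 := by decide
    exact h2 x
  simp only [sum_range_succ, sum_range_zero, zero_add]
  have h3 : K % 3 = 0 ∨ K % 3 = 1 ∨ K % 3 = 2 := by omega
  rcases h3 with h | h | h
  · have h1 : (K + 2 * 1) % 3 ≠ 0 := by omega
    have h2 : (K + 2 * 2) % 3 ≠ 0 := by omega
    simp [h, h1, h2, hx]
  · have h1 : (K + 2 * 1) % 3 = 0 := by omega
    have h2 : (K + 2 * 2) % 3 ≠ 0 := by omega
    simp [h, h1, h2, hx]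
  · have h1 : (K + 2 * 1) % 3 ≠ 0 := by omega
    have h2 : (K + 2 * 2) % 3 = 0 := by omega
    simp [h, h1, h2, hx]

/-- Fibrewise cancellation: if the fire-count parity is the same in the three classes and liveness
depends only on the class through a "two of three" predicate `L`, the signed count vanishes. -/
theorem fiber_sum_zero {ι : Type} [Fintype ι] (cls : ι → ℕ) (hcls : ∀ j, cls j < 3)
    (fire : ι → Bool) (live : ι → Prop) [DecidablePred live] (L : ℕ → Prop) [DecidablePred L]
    (hlive : ∀ j, live j ↔ L (cls j))
    (hL : (∑ b ∈ range 3, if L b then (1 : ZMod 2) else 0) = 0)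
    (hind : ∀ b, b < 3 → (univ.filter fun j => cls j = b ∧ fire j = true).card % 2 =
      (univ.filter fun j => cls j = 0 ∧ fire j = true).card % 2) :
    (∑ j, if fire j = true ∧ live j then (1 : ZMod 2) else 0) = 0 := by
  have hprod : ∀ j, (if fire j = true ∧ live j then (1 : ZMod 2) else 0)
      = (if L (cls j) then (1 : ZMod 2) else 0) * (if fire j = true then 1 else 0) := by
    intro j
    by_cases h1 : fire j = true <;> by_cases h2 : L (cls j) <;> simp [h1, h2, hlive j]
  simp_rw [hprod]
  rw [← sum_fiberwise_of_maps_to (s := univ) (t := range 3) (g := cls)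
    (fun j _ => mem_range.mpr (hcls j))]
  have hfib : ∀ b ∈ range 3, (∑ j ∈ univ.filter (fun j => cls j = b),
      (if L (cls j) then (1 : ZMod 2) else 0) * (if fire j = true then 1 else 0))
      = (if L b then (1 : ZMod 2) else 0) *
        ((univ.filter fun j => cls j = 0 ∧ fire j = true).card : ZMod 2) := by
    intro b hb
    have hb3 := mem_range.mp hb
    have hcast : ((univ.filter fun j => cls j = b ∧ fire j = true).card : ZMod 2)
        = ((univ.filter fun j => cls j = 0 ∧ fire j = true).card : ZMod 2) :=
      (ZMod.natCast_eq_natCast_iff' _ _ 2).mpr (hind b hb3)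
    rw [← hcast]
    have hrw : ∀ j ∈ univ.filter (fun j => cls j = b),
        (if L (cls j) then (1 : ZMod 2) else 0) * (if fire j = true then 1 else 0)
        = (if L b then (1 : ZMod 2) else 0) * (if fire j = true then 1 else 0) := by
      intro j hj
      rw [(mem_filter.mp hj).2]
    rw [sum_congr rfl hrw, ← mul_sum]
    congr 1
    rw [natCast_card_filter, sum_filter]
    apply sum_congr rfl
    intro j _
    by_cases hc : cls j = b <;> simp [hc]
  rw [sum_congr rfl hfib, ← sum_mul, hL, zero_mul]

/-- the summand of the win count of the glued pair `(p i, q j)` at cut `g`, in `ZMod 2`. -/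
def termZ (m c : ℕ) (y : Fin (n + 1) → (Fin n → Bool) → Bool) {ιA ιB : Type}
    (p : ιA → Fin n → Bool) (q : ιB → Fin n → Bool) (i : ιA) (j : ιB) (g : Fin (n + 1)) : ZMod 2 :=
  if y g (glue m (p i) (q j)) = true ∧ (c + g.val + walkExp (glue m (p i) (q j)) g.val) % 3 ≠ 0
  then 1 else 0

/-- **Odd-configuration identity** (ROUND-29 §4.2, elementary form).  `p`, `q`: odd configurations;
`hindA`: for cuts left of the separator the parity of the number of firing partners in Bob-class `b`
does not depend on `b`; `hindB`: symmetrically.  Then some glued pair loses. -/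
theorem configParity {ιA ιB : Type} [Fintype ιA] [Fintype ιB]
    (m c : ℕ) (y : Fin (n + 1) → (Fin n → Bool) → Bool)
    (p : ιA → Fin n → Bool) (q : ιB → Fin n → Bool)
    (hoddA : Fintype.card ιA % 2 = 1) (hoddB : Fintype.card ιB % 2 = 1)
    (hindA : ∀ g : Fin (n + 1), g.val ≤ m → ∀ i : ιA, ∀ b : ℕ, b < 3 →
      (univ.filter fun j : ιB => wtB m (q j) % 3 = b ∧ y g (glue m (p i) (q j)) = true).card % 2 =
      (univ.filter fun j : ιB => wtB m (q j) % 3 = 0 ∧ y g (glue m (p i) (q j)) = true).card % 2)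
    (hindB : ∀ g : Fin (n + 1), m < g.val → ∀ j : ιB, ∀ a : ℕ, a < 3 →
      (univ.filter fun i : ιA => wtA m (p i) % 3 = a ∧ y g (glue m (p i) (q j)) = true).card % 2 =
      (univ.filter fun i : ιA => wtA m (p i) % 3 = 0 ∧ y g (glue m (p i) (q j)) = true).card % 2) :
    ∃ i j, ringWinU c y (glue m (p i) (q j)) = false := by
  by_contra hall
  push Not at hall
  have hone : ∀ i j, (∑ g : Fin (n + 1), termZ m c y p q i j g) = 1 := by
    intro i j
    have h : ringWinU c y (glue m (p i) (q j)) = true := eq_true_of_ne_false (hall i j)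
    unfold ringWinU at h
    have hP := of_decide_eq_true h
    simp only [termZ]
    rw [← natCast_card_filter]
    exact ZMod.natCast_eq_one_iff_odd.mpr (Nat.odd_iff.mpr hP)
  have hzero : ∀ g : Fin (n + 1), (∑ i, ∑ j, termZ m c y p q i j g) = 0 := by
    intro g
    simp only [termZ]
    by_cases hg : g.val ≤ m
    · apply sum_eq_zero
      intro i _
      exact fiber_sum_zero (fun j => wtB m (q j) % 3) (fun j => Nat.mod_lt _ (by norm_num))
        (fun j => y g (glue m (p i) (q j)))
        (fun j => (c + g.val + walkExp (glue m (p i) (q j)) g.val) % 3 ≠ 0)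
        (fun b => (c + g.val + wtA m (p i) + wtPrefix (p i) g.val + b) % 3 ≠ 0)
        (fun j => by
          show (c + g.val + walkExp (glue m (p i) (q j)) g.val) % 3 ≠ 0 ↔
            (c + g.val + wtA m (p i) + wtPrefix (p i) g.val + wtB m (q j) % 3) % 3 ≠ 0
          rw [walkExp_glue_of_le hg]
          constructor <;> intro h <;> omega)
        (sum_three_live _ 1)
        (hindA g hg i)
    · rw [sum_comm]
      apply sum_eq_zero
      intro j _
      have hg' : m ≤ g.val := by omega
      exact fiber_sum_zero (fun i => wtA m (p i) % 3) (fun i => Nat.mod_lt _ (by norm_num))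
        (fun i => y g (glue m (p i) (q j)))
        (fun i => (c + g.val + walkExp (glue m (p i) (q j)) g.val) % 3 ≠ 0)
        (fun a => (c + g.val + wtB m (q j) + wtMid m g.val (q j) + 2 * a) % 3 ≠ 0)
        (fun i => by
          show (c + g.val + walkExp (glue m (p i) (q j)) g.val) % 3 ≠ 0 ↔
            (c + g.val + wtB m (q j) + wtMid m g.val (q j) + 2 * (wtA m (p i) % 3)) % 3 ≠ 0
          rw [walkExp_glue_of_ge hg']
          constructor <;> intro h <;> omega)
        (sum_three_live2 _ 1)
        (hindB g (by omega) j)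
  have hA : (Fintype.card ιA : ZMod 2) = 1 := ZMod.natCast_eq_one_iff_odd.mpr (Nat.odd_iff.mpr hoddA)
  have hB : (Fintype.card ιB : ZMod 2) = 1 := ZMod.natCast_eq_one_iff_odd.mpr (Nat.odd_iff.mpr hoddB)
  have htot : (∑ i : ιA, ∑ j : ιB, ∑ g : Fin (n + 1), termZ m c y p q i j g) = 1 := by
    simp_rw [hone]
    simp only [sum_const, card_univ, nsmul_eq_mul, mul_one, hB, hA]
  have htot0 : (∑ i : ιA, ∑ j : ιB, ∑ g : Fin (n + 1), termZ m c y p q i j g) = 0 := by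
    calc (∑ i : ιA, ∑ j : ιB, ∑ g : Fin (n + 1), termZ m c y p q i j g)
        = ∑ i : ιA, ∑ g : Fin (n + 1), ∑ j : ιB, termZ m c y p q i j g := by
          apply sum_congr rfl; intro i _; rw [sum_comm]
      _ = ∑ g : Fin (n + 1), ∑ i : ιA, ∑ j : ιB, termZ m c y p q i j g := by rw [sum_comm]
      _ = 0 := by rw [sum_congr rfl (fun g _ => hzero g)]; simp
  rw [htot0] at htot
  exact absurd htot (by decide)

/-- `glue` below the separator reads the first argument. -/
theorem glue_apply_lt {m : ℕ} (s s' : Fin n → Bool) {i : Fin n} (h : i.val < m) :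
    glue m s s' i = s i := by simp [glue, h]

/-- `glue` at or above the separator reads the second argument. -/
theorem glue_apply_not_lt {m : ℕ} (s s' : Fin n → Bool) {i : Fin n} (h : ¬ i.val < m) :
    glue m s s' i = s' i := by simp [glue, h]

/-- **Blind corollary** (⇒ stmt-23990 `BlindPairLaw` after double counting, ROUND-29 §1.1): if cuts
`g ≤ m` read only bits `< m` and cuts `g > m` only bits `≥ m`, then among the nine glued pairs of ANY
system of class representatives (`p a` of A-class `a`, `q b` of B-class `b`) at least one is lost. -/
theorem blind_exists_lose (m c : ℕ) (y : Fin (n + 1) → (Fin n → Bool) → Bool)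
    (hA : ∀ g : Fin (n + 1), ∀ u u' : Fin n → Bool, g.val ≤ m →
      (∀ i : Fin n, i.val < m → u i = u' i) → y g u = y g u')
    (hB : ∀ g : Fin (n + 1), ∀ u u' : Fin n → Bool, m < g.val →
      (∀ i : Fin n, m ≤ i.val → u i = u' i) → y g u = y g u')
    (p q : Fin 3 → Fin n → Bool) (hp : ∀ a, wtA m (p a) % 3 = a.val) (hq : ∀ b, wtB m (q b) % 3 = b.val) :
    ∃ a b, ringWinU c y (glue m (p a) (q b)) = false := by
  refine configParity m c y p q (by simp) (by simp) ?_ ?_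
  · intro g hg i b hb
    have hF : ∀ j, y g (glue m (p i) (q j)) = y g (glue m (p i) (q 0)) := fun j =>
      hA g _ _ hg (fun k hk => by rw [glue_apply_lt _ _ hk, glue_apply_lt _ _ hk])
    simp_rw [hF, hq]
    by_cases hC : y g (glue m (p i) (q 0)) = true
    · simp only [hC, and_true]
      interval_cases b <;> decide
    · simp [hC]
  · intro g hg j a ha
    have hF : ∀ i, y g (glue m (p i) (q j)) = y g (glue m (p 0) (q j)) := fun i =>
      hB g _ _ hg (fun k hk => by
        rw [glue_apply_not_lt _ _ (by omega), glue_apply_not_lt _ _ (by omega)])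
    simp_rw [hF, hp]
    by_cases hC : y g (glue m (p 0) (q j)) = true
    · simp only [hC, and_true]
      interval_cases a <;> decide
    · simp [hC]

end Summit.QuantumAdvantage.AdviceFreeQNC0.OddConfig
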